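import Mathlib.Algebra.MvPolynomial.Funext
import Mathlib.Algebra.Polynomial.Roots
import Mathlib.GroupTheory.Perm.Sign
import Mathlib.Algebra.Group.Submonoid.Finite
import Literature.NumberTheory.Automorphic.HarishChandraGLModel
import HarnessLib

/-!
# Proof of Harish-Chandra's theorem (existence) for `𝔤𝔩ₙ(𝕜)`: `nonempty_harishChandraHomGL`

Topic `Literature/NumberTheory/Automorphic`. This file discharges, sorry-free, the named fact
`Literature.NumberTheory.Automorphic.nonempty_harishChandraHomGL` of
`Literature/NumberTheory/Automorphic/HarishChandraGL.lean`: for `𝕜 = ℝ` or `ℂ` (`[RCLike 𝕜]`) and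
every `n`, a Harish-Chandra homomorphism `γ : Z(𝔤𝔩ₙ(𝕜)) →ₐ[ℝ] ℂ[x_{τ,i}]` with `∏_τ 𝔖ₙ`-symmetric
values and the highest weight normalisation `z v = γ(z)(λ + ρ) v` exists
(`nonempty_harishChandraHomGL_holds`). (Uniqueness, the named fact `harishChandraHomGL_unique`,
is discharged independently in `HarishChandraGLProofs` by a polynomial model; the model of
`HarishChandraGLModel` also lives in `Type` and would give another proof.) As a corollary of the
axioms alone, the named fact `hasHCParameter_trivial` (the trivial representation has parameter
`ρ`) is discharged at the end of the file.

Sources: A. W. Knapp, *Lie Groups Beyond an Introduction*, 2nd ed. (2002), §V.5, Theorem 5.44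
(`γ = τ_δ ∘ γ'ₙ` is an algebra homomorphism of `Z(𝔤)` into `U(𝔥)^W`, with Lemma 5.42, (5.43)), with
§VI.1 for the complexification `𝔤𝔩ₙ(𝕜)_ℂ = ∏_τ 𝔤𝔩ₙ(ℂ)`; J. E. Humphreys, GTM 9 (1972), §23.2
(Proposition, Corollary, Corollary': `χ_λ = χ_μ` for linked `λ ∼ μ`) and §23.3 (`ξ`, `η`,
`ψ = η ∘ ξ|_𝔷`, `χ_λ(z) = (λ + δ)(ψ(z))`, and "`ψ` maps `𝔷` into `𝔖(H)^W`"), whose argument (for a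
semisimple `L`; verbatim for the reductive `𝔤𝔩ₙ`) is the one formalised here.

Relation to the sibling files of the tree. `HarishChandraGLProofs` proves uniqueness of `γ`
(`harishChandraHomGL_unique`), and `HarishChandraCore` + `HarishChandraGLIsomorphism` prove
`harishChandraHomGL_bijective_symmetric` (injectivity and range of `ℂ ⊗ γ`) for EVERY
`γ : HarishChandraHomGL 𝕜 n` — i.e. *assuming* a `γ` with the highest weight property and
`∏_τ 𝔖ₙ`-symmetric values is given (the symmetry of the values is a hypothesis there, used in the
surjectivity step). The present file supplies exactly that input: the existence of such a `γ`,
whose substance is the `W`-symmetry of the Harish-Chandra polynomial of a central element; this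
is the step that needs modules with *free* lowering strings (`HarishChandraGLModel`), which the
polynomial models of `HarishChandraGLProofs` / `HighestWeightGL` do not have.

## The proof

* `γ(z)` is `HCProj.hcPoly z` (file `HarishChandraGLProjection`): project a triangular expansion of
  `z` (file `HarishChandraGLSpan`, the spanning half of PBW) to `U(𝔥) = ℂ[x_{τ,i}]` and shift by
  `ρ`; `HCProj.lift_center_apply` is the highest weight property, valid in every module.
* The polynomial `γ(z)` is determined by its values `γ(z)(λ + ρ)`, `λ ∈ 𝔥_ℂ^*`, and these are the
  scalars by which `z` acts on the highest weight vectors `HCModel.hwVec λ ≠ 0` of the model of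
  `HarishChandraGLModel` (`eq_of_forall_weight`). Multiplicativity, additivity and `ℝ`-linearity of
  `z ↦ γ(z)` follow (`hcAlgHom`), as in Humphreys §23.3 ("the restriction of `ξ` to `𝔷` is an
  algebra homomorphism, thanks to (*)").
* `W`-invariance (Humphreys §23.2 Corollary and §23.3; Knapp, Thm. 5.44) — the step for which the
  model of `HarishChandraGLModel` (free lowering strings) is needed rather than the polynomial
  model of `HarishChandraGLProofs` (whose strings are finite): for a simple root
  `α = e_{τ,i} - e_{τ,i+1}` and `λ` with `m = ⟨λ + ρ, α^∨⟩ ∈ ℕ`, the vector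
  `F_α^m (HCModel.hwVec λ) ≠ 0`
  (`HCModel.pow_E_hwVec_ne_zero`) is a highest weight vector of weight `s_α(λ + ρ) - ρ`
  (`HCWt.FactorRep.isHighestWeightVector_pow`) on which `z` acts both by `γ(z)(λ + ρ)` and by
  `γ(z)(s_α(λ + ρ))`; so `γ(z) ∘ s_α = γ(z)` on the Zariski dense set `{x_{τ,i} - x_{τ,i+1} ∈ ℕ}`,
  hence everywhere (`mvPolynomial_eq_of_nat_sub`, a one-variable "infinitely many roots"
  argument), and the adjacent transpositions generate `∏_τ 𝔖ₙ`
  (`Equiv.Perm.mclosure_swap_castSucc_succ`, `Submonoid.pi_mem_of_mulSingle_mem`).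

## Main statements

* `Literature.Automorphic.harishChandraHomGL 𝕜 n` — the Harish-Chandra homomorphism (data).
* `Literature.NumberTheory.Automorphic.nonempty_harishChandraHomGL_holds` — `nonempty_harishChandraHomGL 𝕜 n`.
* `Literature.NumberTheory.Automorphic.hasHCParameter_trivial_holds` — the named fact `hasHCParameter_trivial 𝕜 n`:
  the trivial representation has Harish-Chandra parameter `ρ` (highest weight `0`, symmetry).

## References

* A. W. Knapp, *Lie Groups Beyond an Introduction*, 2nd ed., Birkhäuser 2002, Thm. 5.44,
  Lemma 5.42, (5.43), §V.3, §VI.1.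
* J. E. Humphreys, *Introduction to Lie Algebras and Representation Theory*, GTM 9, Springer 1972,
  §21.2, §23.2, §23.3.
-/

attribute [local instance 100] LieRing.ofAssociativeRing

open scoped Matrix

noncomputable section

namespace Literature.NumberTheory.Automorphic

open HCSpan HCProj HCWt MvPolynomial

/-! ### A density lemma for multivariate polynomials -/

/-- A multivariate polynomial over `ℂ` vanishing at all points `x` with `x_a - x_b ∈ ℕ` (`a ≠ b`)
is zero: restricted to the lines `x_a = x_b + t` it has infinitely many roots. [folklore] -/
theorem mvPolynomial_eq_of_nat_sub {σ : Type*} (P Q : MvPolynomial σ ℂ) (a b : σ) (hab : a ≠ b)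
    (h : ∀ x : σ → ℂ, (∃ m : ℕ, x a - x b = m) → aeval x P = aeval x Q) : P = Q := by
  classical
  apply MvPolynomial.funext
  intro x
  let g : σ → Polynomial ℂ := fun s ↦
    if s = a then Polynomial.X + Polynomial.C (x b) else Polynomial.C (x s)
  have hg : ∀ t : ℂ, (fun s ↦ Polynomial.aeval t (g s)) = Function.update x a (t + x b) := by
    intro t
    funext s
    by_cases hs : s = a
    · subst hs; simp [g]
    · simp [g, hs]
  have e : ∀ (t : ℂ) (R : MvPolynomial σ ℂ),
      Polynomial.eval t (aeval g R) = aeval (Function.update x a (t + x b)) R := by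
    intro t R
    rw [← Polynomial.coe_aeval_eq_eval, ← hg t, ← AlgHom.comp_apply, MvPolynomial.comp_aeval]
  have key : aeval g P - aeval g Q = 0 := by
    apply Polynomial.eq_zero_of_infinite_isRoot
    apply Set.infinite_of_injective_forall_mem (f := fun m : ℕ ↦ (m : ℂ)) Nat.cast_injective
    intro m
    simp only [Set.mem_setOf_eq, Polynomial.IsRoot.def, Polynomial.eval_sub, e, sub_eq_zero]
    refine h _ ⟨m, ?_⟩
    rw [Function.update_self, Function.update_of_ne (Ne.symm hab)]
    ring
  have := congrArg (Polynomial.eval (x a - x b)) key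
  rw [Polynomial.eval_sub, Polynomial.eval_zero, e, e, sub_add_cancel, Function.update_eq_self,
    sub_eq_zero] at this
  exact this

variable (𝕜 : Type*) [RCLike 𝕜] (n : ℕ)

/-! ### Values on highest weight vectors determine `γ(z)` -/

/-- Two polynomials on `𝔥_ℂ^*` that agree at all points `λ + ρ` are equal. [folklore] -/
theorem eq_of_forall_weight (P Q : MvPolynomial ((𝕜 →ₐ[ℝ] ℂ) × Fin n) ℂ)
    (h : ∀ l : ArchWeightGL 𝕜 n,
      aeval (fun p : (𝕜 →ₐ[ℝ] ℂ) × Fin n ↦ l p.1 p.2 + rhoGL n p.2) P =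
        aeval (fun p : (𝕜 →ₐ[ℝ] ℂ) × Fin n ↦ l p.1 p.2 + rhoGL n p.2) Q) : P = Q := by
  apply MvPolynomial.funext
  intro x
  have hx := h (fun τ j ↦ x (τ, j) - rhoGL n j)
  simp only [sub_add_cancel, Prod.mk.eta] at hx
  exact hx

/-- The scalar by which a central `z` acts on the highest weight vector `HCModel.hwVec l` of the
model is
`γ(z)(l + ρ)`; two such scalars are equal as soon as the actions agree. [folklore] -/
theorem smul_hwVec_injective (l : ArchWeightGL 𝕜 n) :
    Function.Injective fun c : ℂ ↦ c • HCModel.hwVec (𝕜 := 𝕜) l :=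
  smul_left_injective ℂ (HCModel.hwVec_ne_zero l)

/-- `γ(z₁ z₂) = γ(z₁) γ(z₂)`. Knapp, Thm. 5.44 (γ is an algebra homomorphism). [folklore] -/
theorem hcPoly_mul (z₁ z₂ : Subalgebra.center ℝ (UGL 𝕜 n)) :
    hcPoly 𝕜 n (z₁ * z₂) = hcPoly 𝕜 n z₁ * hcPoly 𝕜 n z₂ := by
  refine eq_of_forall_weight 𝕜 n _ _ fun l ↦ ?_
  have hv := HCModel.isHighestWeightVector_hwVec (𝕜 := 𝕜) l
  have h12 := lift_center_apply (z₁ * z₂) (HCModel.modelRep 𝕜 n).rho hv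
  rw [Subalgebra.coe_mul, map_mul, Module.End.mul_apply, lift_center_apply z₂ _ hv, map_smul,
    lift_center_apply z₁ _ hv, smul_smul] at h12
  rw [map_mul]
  exact (smul_hwVec_injective 𝕜 n l h12).symm.trans (mul_comm _ _)

/-- `γ(z₁ + z₂) = γ(z₁) + γ(z₂)`. [folklore] -/
theorem hcPoly_add (z₁ z₂ : Subalgebra.center ℝ (UGL 𝕜 n)) :
    hcPoly 𝕜 n (z₁ + z₂) = hcPoly 𝕜 n z₁ + hcPoly 𝕜 n z₂ := by
  refine eq_of_forall_weight 𝕜 n _ _ fun l ↦ ?_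
  have hv := HCModel.isHighestWeightVector_hwVec (𝕜 := 𝕜) l
  have h12 := lift_center_apply (z₁ + z₂) (HCModel.modelRep 𝕜 n).rho hv
  rw [Subalgebra.coe_add, map_add, LinearMap.add_apply, lift_center_apply z₂ _ hv,
    lift_center_apply z₁ _ hv, ← add_smul] at h12
  rw [map_add]
  exact (smul_hwVec_injective 𝕜 n l h12).symm

/-- `γ(1) = 1`. [folklore] -/
theorem hcPoly_one : hcPoly 𝕜 n (1 : Subalgebra.center ℝ (UGL 𝕜 n)) = 1 := by
  refine eq_of_forall_weight 𝕜 n _ _ fun l ↦ ?_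
  have hv := HCModel.isHighestWeightVector_hwVec (𝕜 := 𝕜) l
  have h1 := lift_center_apply (1 : Subalgebra.center ℝ (UGL 𝕜 n)) (HCModel.modelRep 𝕜 n).rho hv
  rw [Subalgebra.coe_one, map_one, Module.End.one_apply] at h1
  rw [map_one]
  have h1' : (1 : ℂ) • HCModel.hwVec l =
      aeval (fun p : (𝕜 →ₐ[ℝ] ℂ) × Fin n ↦ l p.1 p.2 + rhoGL n p.2)
      (hcPoly 𝕜 n 1) • HCModel.hwVec l := by rwa [one_smul]
  exact (smul_hwVec_injective 𝕜 n l h1').symm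

/-- `γ(r) = r` for `r ∈ ℝ`. [folklore] -/
theorem hcPoly_algebraMap (r : ℝ) :
    hcPoly 𝕜 n (algebraMap ℝ (Subalgebra.center ℝ (UGL 𝕜 n)) r) =
      algebraMap ℝ (MvPolynomial ((𝕜 →ₐ[ℝ] ℂ) × Fin n) ℂ) r := by
  refine eq_of_forall_weight 𝕜 n _ _ fun l ↦ ?_
  have hv := HCModel.isHighestWeightVector_hwVec (𝕜 := 𝕜) l
  have h1 := lift_center_apply (algebraMap ℝ (Subalgebra.center ℝ (UGL 𝕜 n)) r)
    (HCModel.modelRep 𝕜 n).rho hv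
  rw [Subalgebra.coe_algebraMap, AlgHom.commutes, Module.algebraMap_end_apply,
    ← Complex.coe_smul] at h1
  rw [IsScalarTower.algebraMap_apply ℝ ℂ (MvPolynomial ((𝕜 →ₐ[ℝ] ℂ) × Fin n) ℂ) r,
    AlgHom.commutes, Algebra.algebraMap_self, RingHom.id_apply, Complex.coe_algebraMap]
  exact (smul_hwVec_injective 𝕜 n l h1).symm

/-- **The Harish-Chandra homomorphism as a real algebra homomorphism**
`γ : Z(𝔤𝔩ₙ(𝕜)) →ₐ[ℝ] ℂ[x_{τ,i}]`. Knapp, Thm. 5.44; Humphreys, §23.3 ("the restriction of `ξ` to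
`𝔷` is an *algebra* homomorphism, thanks to (*)", `ψ = η ∘ ξ|_𝔷`). [cite: Knapp2002, Thm. 5.44] -/
def hcAlgHom : Subalgebra.center ℝ (UGL 𝕜 n) →ₐ[ℝ] MvPolynomial ((𝕜 →ₐ[ℝ] ℂ) × Fin n) ℂ where
  toFun := hcPoly 𝕜 n
  map_one' := hcPoly_one 𝕜 n
  map_mul' := hcPoly_mul 𝕜 n
  map_zero' := by simpa using hcPoly_algebraMap 𝕜 n 0
  map_add' := hcPoly_add 𝕜 n
  commutes' := hcPoly_algebraMap 𝕜 n

/-- Unfolding `hcAlgHom`. [folklore] -/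
theorem hcAlgHom_apply (z : Subalgebra.center ℝ (UGL 𝕜 n)) : hcAlgHom 𝕜 n z = hcPoly 𝕜 n z := rfl

/-! ### Weyl group symmetry -/

open scoped Classical in
/-- **Symmetry under one simple reflection, at the lattice points**: for `x ∈ 𝔥_ℂ^*` with
`x_{τ,i} - x_{τ,i+1} ∈ ℕ`, `γ(z)(s_{α} x) = γ(z)(x)` (`α = e_{τ,i} - e_{τ,i+1}`). Humphreys, §23.2,
Corollary (`χ_λ = χ_μ` for `μ = σ_α(λ + δ) - δ`, via the maximal vector `y_α^{m+1} v⁺` of the Verma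
module `Z(λ)`); here via the model of `HarishChandraGLModel`. [folklore] -/
theorem aeval_hcPoly_swap (z : Subalgebra.center ℝ (UGL 𝕜 n)) (τ : 𝕜 →ₐ[ℝ] ℂ) {i i' : Fin n}
    (hi : (i' : ℕ) = i + 1) (x : (𝕜 →ₐ[ℝ] ℂ) × Fin n → ℂ) (hx : ∃ m : ℕ, x (τ, i) - x (τ, i') = m) :
    aeval (x ∘ Equiv.prodCongrRight (Pi.mulSingle τ (Equiv.swap i i'))) (hcPoly 𝕜 n z) =
      aeval x (hcPoly 𝕜 n z) := by
  obtain ⟨m, hm⟩ := hx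
  set l : ArchWeightGL 𝕜 n := fun τ' j ↦ x (τ', j) - rhoGL n j with hl
  have hx' : (fun p : (𝕜 →ₐ[ℝ] ℂ) × Fin n ↦ l p.1 p.2 + rhoGL n p.2) = x :=
    funext fun p ↦ by simp [hl]
  have hρ : rhoGL n i = rhoGL n i' + 1 := by
    simp only [rhoGL, hi]
    push_cast
    ring
  have hm' : (m : ℂ) = l τ i - l τ i' + 1 := by
    rw [← hm, hl]
    simp only
    rw [hρ]
    ring
  have hv := HCModel.isHighestWeightVector_hwVec (𝕜 := 𝕜) l
  have hw :=
    (HCModel.modelRep 𝕜 n).isHighestWeightVector_pow hv hi hm'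
      (HCModel.pow_E_hwVec_ne_zero l τ hi m)
  have h1 := lift_center_apply z (HCModel.modelRep 𝕜 n).rho hv
  have h2 := lift_center_apply z (HCModel.modelRep 𝕜 n).rho hw
  rw [← (HCModel.modelRep 𝕜 n).E_pow_lift_center z.2 τ i' i m (HCModel.hwVec l), h1, map_smul,
    shiftWt_add_rho l τ hi hm', hx'] at h2
  exact (smul_left_injective ℂ hw.1 h2).symm

open scoped Classical in
/-- **Symmetry under one simple reflection.** `γ(z)` is invariant under the transposition
`(i, i+1)` in the factor `τ`. Humphreys, §23.2 Corollary and §23.3; Knapp, Thm. 5.44. [folklore] -/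
theorem rename_swap_hcPoly (z : Subalgebra.center ℝ (UGL 𝕜 n)) (τ : 𝕜 →ₐ[ℝ] ℂ) {i i' : Fin n}
    (hi : (i' : ℕ) = i + 1) :
    rename (Equiv.prodCongrRight (Pi.mulSingle τ (Equiv.swap i i'))) (hcPoly 𝕜 n z) =
      hcPoly 𝕜 n z := by
  refine mvPolynomial_eq_of_nat_sub _ _ (τ, i) (τ, i') (fun h ↦ ?_) fun x hx ↦ ?_
  · have : (i : ℕ) = i' := congrArg (fun p : (𝕜 →ₐ[ℝ] ℂ) × Fin n ↦ (p.2 : ℕ)) h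
    omega
  · rw [aeval_rename]
    exact aeval_hcPoly_swap 𝕜 n z τ hi x hx

/-- The `τ`-wise permutations leaving `γ(z)` invariant form a submonoid of `∏_τ 𝔖ₙ`. [folklore] -/
def symmStab (P : MvPolynomial ((𝕜 →ₐ[ℝ] ℂ) × Fin n) ℂ) :
    Submonoid ((𝕜 →ₐ[ℝ] ℂ) → Equiv.Perm (Fin n)) where
  carrier := {σ | rename (Equiv.prodCongrRight σ) P = P}
  one_mem' := by
    show rename _ P = P
    have : (⇑(Equiv.prodCongrRight (1 : (𝕜 →ₐ[ℝ] ℂ) → Equiv.Perm (Fin n))) :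
        (𝕜 →ₐ[ℝ] ℂ) × Fin n → (𝕜 →ₐ[ℝ] ℂ) × Fin n) = id := funext fun p ↦ rfl
    rw [this, rename_id]
    rfl
  mul_mem' {σ σ'} hσ hσ' := by
    show rename _ P = P
    have : (⇑(Equiv.prodCongrRight (σ * σ')) : (𝕜 →ₐ[ℝ] ℂ) × Fin n → (𝕜 →ₐ[ℝ] ℂ) × Fin n) =
        ⇑(Equiv.prodCongrRight σ) ∘ ⇑(Equiv.prodCongrRight σ') := funext fun p ↦ rfl
    rw [this, ← rename_rename, show rename _ P = P from hσ', show rename _ P = P from hσ]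

/-- Membership in `symmStab`. [folklore] -/
theorem mem_symmStab_iff (P : MvPolynomial ((𝕜 →ₐ[ℝ] ℂ) × Fin n) ℂ)
    (σ : (𝕜 →ₐ[ℝ] ℂ) → Equiv.Perm (Fin n)) :
    σ ∈ symmStab 𝕜 n P ↔ rename (Equiv.prodCongrRight σ) P = P :=
  Iff.rfl

open scoped Classical in
/-- **Weyl group symmetry of `γ(z)`**: invariance under all of `W = ∏_τ 𝔖ₙ`, since `𝔖ₙ` is
generated by adjacent transpositions. Knapp, Thm. 5.44; Humphreys, §23.2 Corollary' and §23.3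
("`ψ` maps `𝔷` into `𝔖(H)^W`"). [cite: Humphreys1972, §23.3] -/
theorem rename_hcPoly (z : Subalgebra.center ℝ (UGL 𝕜 n))
    (σ : (𝕜 →ₐ[ℝ] ℂ) → Equiv.Perm (Fin n)) :
    rename (Equiv.prodCongrRight σ) (hcPoly 𝕜 n z) = hcPoly 𝕜 n z := by
  rw [← mem_symmStab_iff]
  refine Submonoid.pi_mem_of_mulSingle_mem σ fun τ ↦ ?_
  -- every permutation of the factor `τ` stabilises `γ(z)`
  suffices h : ∀ π : Equiv.Perm (Fin n), Pi.mulSingle τ π ∈ symmStab 𝕜 n (hcPoly 𝕜 n z) from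
    h (σ τ)
  intro π
  revert π
  cases n with
  | zero => intro π; rw [Subsingleton.elim π 1, Pi.mulSingle_one]; exact Submonoid.one_mem _
  | succ k =>
    have hcl := Equiv.Perm.mclosure_swap_castSucc_succ k
    intro π
    have hπ : π ∈ Submonoid.closure (Set.range fun i : Fin k ↦ Equiv.swap i.castSucc i.succ) := by
      rw [hcl]; exact Submonoid.mem_top π
    refine Submonoid.closure_induction (fun π' hπ' ↦ ?_) ?_ (fun π₁ π₂ _ _ h₁ h₂ ↦ ?_) hπ
    · obtain ⟨j, rfl⟩ := hπ'
      rw [mem_symmStab_iff]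
      exact rename_swap_hcPoly 𝕜 (k + 1) z τ (by simp)
    · rw [Pi.mulSingle_one]; exact Submonoid.one_mem _
    · rw [Pi.mulSingle_mul]; exact Submonoid.mul_mem _ h₁ h₂

/-! ### The theorem -/

/-- **The Harish-Chandra homomorphism of `𝔤𝔩ₙ(𝕜)`** (`𝕜 = ℝ` or `ℂ`): the real algebra
homomorphism `γ = τ_ρ ∘ γ' : Z(𝔤) → ℂ[x_{τ,i}]`, with `∏_τ 𝔖ₙ`-symmetric values, acting on highest
weight vectors of weight `λ` by `γ(z)(λ + ρ)`. Knapp, *Lie Groups Beyond an Introduction*,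
Thm. 5.44 with Lemma 5.42 / (5.43) and §VI.1. [cite: Knapp2002, Thm. 5.44] -/
def harishChandraHomGL : HarishChandraHomGL 𝕜 n where
  toAlgHom := hcAlgHom 𝕜 n
  symmetric σ z := rename_hcPoly 𝕜 n z σ
  highestWeight _ _ _ ρ𝔤 _ _ hv z := lift_center_apply z ρ𝔤 hv

/-- **Harish-Chandra's theorem (existence) for `𝔤𝔩ₙ(𝕜)`, `𝕜 = ℝ` or `ℂ`**: a Harish-Chandra
homomorphism exists; this discharges the named fact `nonempty_harishChandraHomGL`.
Knapp, *Lie Groups Beyond an Introduction*, 2nd ed. (2002), §V.5, Thm. 5.44, with Lemma 5.42,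
(5.43) and §VI.1. [cite: Knapp2002, Thm. 5.44] -/
theorem nonempty_harishChandraHomGL_holds : nonempty_harishChandraHomGL 𝕜 n :=
  ⟨harishChandraHomGL 𝕜 n⟩

/-! ### The trivial representation has Harish-Chandra parameter `ρ` -/

/-- The **augmentation character** `θ₀ : Z(𝔤) → ℂ`: the scalar by which `z ∈ Z(𝔤)` acts on the
trivial one-dimensional module `ℂ` (`ρ = 0`), i.e. the constant term of `z`. Knapp, §V.5,
discussion of (5.43). [folklore] -/
def trivialCentralChar : Subalgebra.center ℝ (UGL 𝕜 n) →ₐ[ℝ] ℂ where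
  toFun z := UniversalEnvelopingAlgebra.lift ℝ
    (0 : Matrix (Fin n) (Fin n) 𝕜 →ₗ⁅ℝ⁆ Module.End ℂ ℂ) (z : UGL 𝕜 n) 1
  map_one' := by simp
  map_mul' z₁ z₂ := by
    have h : ∀ (u : UGL 𝕜 n) (c : ℂ), UniversalEnvelopingAlgebra.lift ℝ
        (0 : Matrix (Fin n) (Fin n) 𝕜 →ₗ⁅ℝ⁆ Module.End ℂ ℂ) u c =
        c * UniversalEnvelopingAlgebra.lift ℝ
          (0 : Matrix (Fin n) (Fin n) 𝕜 →ₗ⁅ℝ⁆ Module.End ℂ ℂ) u 1 := by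
      intro u c
      conv_lhs => rw [← mul_one c, ← smul_eq_mul, map_smul, smul_eq_mul]
    rw [Subalgebra.coe_mul, map_mul, Module.End.mul_apply, h, mul_comm]
  map_zero' := by simp
  map_add' z₁ z₂ := by
    rw [Subalgebra.coe_add, map_add, LinearMap.add_apply]
  commutes' r := by
    rw [Subalgebra.coe_algebraMap, AlgHom.commutes, Module.algebraMap_end_apply,
      ← Complex.coe_smul, smul_eq_mul, mul_one, Complex.coe_algebraMap]

/-- Unfolding `trivialCentralChar`. [folklore] -/
theorem trivialCentralChar_apply (z : Subalgebra.center ℝ (UGL 𝕜 n)) :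
    trivialCentralChar 𝕜 n z = UniversalEnvelopingAlgebra.lift ℝ
      (0 : Matrix (Fin n) (Fin n) 𝕜 →ₗ⁅ℝ⁆ Module.End ℂ ℂ) (z : UGL 𝕜 n) 1 :=
  rfl

/-- The trivial module `ℂ` has central character `θ₀`. [folklore] -/
theorem hasCentralCharacter_trivial :
    HasCentralCharacter (0 : Matrix (Fin n) (Fin n) 𝕜 →ₗ⁅ℝ⁆ Module.End ℂ ℂ)
      (trivialCentralChar 𝕜 n) := by
  intro z
  refine LinearMap.ext fun c ↦ ?_
  rw [Module.algebraMap_end_apply, trivialCentralChar_apply, smul_eq_mul, mul_comm]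
  conv_lhs => rw [← mul_one c, ← smul_eq_mul, map_smul, smul_eq_mul]

/-- `1 ∈ ℂ` is a highest weight vector of weight `0` of the trivial module. [folklore] -/
theorem isHighestWeightVector_trivial :
    IsHighestWeightVector (0 : Matrix (Fin n) (Fin n) 𝕜 →ₗ⁅ℝ⁆ Module.End ℂ ℂ)
      (0 : ArchWeightGL 𝕜 n) (1 : ℂ) :=
  ⟨one_ne_zero, fun X _ ↦ by simp, fun h ↦ by simp [weightFun]⟩

/-- Two enumerations of the same multiset differ by a permutation (the target one injective).
[folklore] -/
theorem exists_perm_of_map_univ_eq {α : Type*} {m : ℕ} {f g : Fin m → α}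
    (hg : Function.Injective g) (h : Finset.univ.val.map f = Finset.univ.val.map g) :
    ∃ σ : Equiv.Perm (Fin m), f = g ∘ σ := by
  classical
  have hex : ∀ i, ∃ j, f j = g i := fun i ↦ by
    have : g i ∈ Finset.univ.val.map f := h ▸ Multiset.mem_map_of_mem g (Finset.mem_univ_val i)
    obtain ⟨j, -, hj⟩ := Multiset.mem_map.mp this
    exact ⟨j, hj⟩
  choose k hk using hex
  have hinj : Function.Injective k := fun i i' hii' ↦ hg (by rw [← hk i, ← hk i', hii'])
  set e : Fin m ≃ Fin m := Equiv.ofBijective k (Finite.injective_iff_bijective.mp hinj) with he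
  refine ⟨e.symm, funext fun j ↦ ?_⟩
  have hj : k (e.symm j) = j := e.apply_symm_apply j
  rw [Function.comp_apply, ← hk (e.symm j), hj]

/-- **The trivial representation of `𝔤𝔩ₙ(𝕜)` has Harish-Chandra parameter `ρ`** at every
embedding `τ`: it is a highest weight module of highest weight `0`, so `z ∈ Z(𝔤)` acts on it by
`γ(z)(0 + ρ) = γ(z)(ρ)`, and `γ(z)` is `τ`-wise symmetric; this discharges the named fact
`hasHCParameter_trivial`. Knapp, *Lie Groups Beyond an Introduction*, §V.5, (5.43) and Thm. 5.44;
Buzzard–Gee 2014, §5. [cite: Knapp2002, Thm. 5.44] -/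
theorem hasHCParameter_trivial_holds : hasHCParameter_trivial 𝕜 n := by
  refine ⟨fun τ ↦ by simp, trivialCentralChar 𝕜 n, hasCentralCharacter_trivial 𝕜 n, ?_⟩
  intro γ l hl z
  -- `rhoGL n` has distinct coordinates (cf. `rhoGL_injective` in `ArchimedeanGLn`)
  have hinj : Function.Injective (rhoGL n) := fun i j h ↦
    Fin.ext (by simpa only [rhoGL, sub_right_inj, Nat.cast_inj] using h)
  choose σ hσ using fun τ ↦ exists_perm_of_map_univ_eq hinj (hl τ)
  have key := γ.highestWeight ℂ (0 : Matrix (Fin n) (Fin n) 𝕜 →ₗ⁅ℝ⁆ Module.End ℂ ℂ) 0 1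
    (isHighestWeightVector_trivial 𝕜 n) z
  rw [smul_eq_mul, mul_one] at key
  rw [trivialCentralChar_apply, key]
  have hl' : (fun p : (𝕜 →ₐ[ℝ] ℂ) × Fin n ↦ l p.1 p.2) =
      (fun p : (𝕜 →ₐ[ℝ] ℂ) × Fin n ↦ (0 : ArchWeightGL 𝕜 n) p.1 p.2 + rhoGL n p.2) ∘
        Equiv.prodCongrRight σ := by
    funext ⟨τ, j⟩
    simp only [Function.comp_apply, Equiv.prodCongrRight_apply, Pi.zero_apply, zero_add, hσ τ]
  rw [hl', ← aeval_rename, γ.symmetric]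

end Literature.NumberTheory.Automorphic
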